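import Literature.Topology.FourManifolds.GompfFramedTwistTransport
import HarnessLib

/-!
# Points of the glued mapping torus from a real base parameter

The mapping torus `X_ψ = T³ × ℝ / (x, s) ∼ (ψ x, s + 1)` of a diffeomorphism `ψ` of `T³` is glued
from the cylinders `T³ × (0, 1)` and `T³ × (1/2, 3/2)` (`MTorus ψ`, `GompfFramedTwistTransport.lean`).
Explicit maps into it (the embedding of the fishtail end model into the shear model: the proof of
R. Gompf, *More Cappell–Shaneson spheres are standard*, Algebr. Geom. Topol. 10 (2010), Lemma 2.2
in the model) are most easily written from a *real* base parameter `s ∈ (0, 3/2)`; this file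
provides the constructor and its calculus:

* `Literature.Topology.FourManifolds.mtPt ψ x s` — the point `[x, s]` read in the second cylinder
  for `s ∈ (1/2, 3/2)` and in the first for `s ∈ (0, 1/2]` (the two agree on `(1/2, 1)`,
  `mtPt_of_mem_one`), i.e. the point with fibre coordinate `x` in the trivialisation of the second
  cylinder extended down to `0`;
* smoothness in `(x, s)` on `T³ × (0, 3/2)` (`contMDiffAt_mtPt`, `contMDiffAt_mtPt_comp`);
* the **monodromy relation** `mtPt ψ x (s + 1) = mtPt ψ (ψ⁻¹ x) s` for `s ∈ (0, 1/2)`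
  (`mtPt_add_one`), and injectivity on `T³ × (1/2, 3/2)` and on `T³ × (0, 1)`.

Everything is proved; no named facts.

## References

* R. E. Gompf, *More Cappell–Shaneson spheres are standard*, Algebr. Geom. Topol. 10 (2010)
  1665–1681, §2 ¶1 (the mapping tori `X_φ`). [GompfAGT2010]
-/

noncomputable section

open scoped Manifold ContDiff Topology
open Set Function Filter

namespace Literature.Topology.FourManifolds

local notation "𝔼" n => EuclideanSpace ℝ (Fin n)
local notation "𝕊 " n:arg => (Metric.sphere (0 : EuclideanSpace ℝ (Fin (n + 1))) 1)
local notation "𝓣" =>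
  (ModelWithCorners.prod (𝓡 1) (ModelWithCorners.prod (𝓡 1) (𝓡 1)))

variable (ψ : ThreeTorus ≃ₘ⟮𝓣, 𝓣⟯ ThreeTorus)

/-- **The point `[x, s]` of the mapping torus from a real base parameter**: in the second cylinder
for `s ∈ (1/2, 3/2)`, in the first for `s ∈ (0, 1/2]` (junk `[x, 1/2]` off `(0, 3/2)`). [cite: GompfAGT2010, §2 (X_φ = T³ × ℝ/(x,s) ∼ (φx, s+1))] -/
def mtPt (x : ThreeTorus) (s : ℝ) : MTorus ψ :=
  if h : 1 / 2 < s ∧ s < 3 / 2 then (mtGlueData ψ).inr (x, ⟨s, h⟩)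
  else if h' : 0 < s ∧ s < 1 then (mtGlueData ψ).inl (x, ⟨s, h'⟩)
  else (mtGlueData ψ).inl (x, ⟨1 / 2, half_mem_pieceOne⟩)

variable {ψ}

/-- On `(1/2, 3/2)` the point is read in the second cylinder. [folklore] -/
theorem mtPt_of_mem_two (x : ThreeTorus) {s : ℝ} (h : 1 / 2 < s ∧ s < 3 / 2) :
    mtPt ψ x s = (mtGlueData ψ).inr (x, ⟨s, h⟩) := by
  rw [mtPt, dif_pos h]

/-- **On `(0, 1)` the point is read in the first cylinder** (on `(1/2, 1)` the two cylinders are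
identified identically). [folklore] -/
theorem mtPt_of_mem_one (x : ThreeTorus) {s : ℝ} (h : 0 < s ∧ s < 1) :
    mtPt ψ x s = (mtGlueData ψ).inl (x, ⟨s, h⟩) := by
  by_cases h2 : 1 / 2 < s ∧ s < 3 / 2
  · rw [mtPt_of_mem_two x h2, eq_comm, mappingTorusGlued_inl_eq_inr_iff, mappingTorusRel]
    left; exact ⟨rfl, rfl⟩
  · rw [mtPt, dif_neg h2, dif_pos h]

/-- **The monodromy relation**: `[x, s + 1] = [ψ⁻¹ x, s]` for `s ∈ (0, 1/2)`. [cite: GompfAGT2010, §2] -/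
theorem mtPt_add_one (x : ThreeTorus) {s : ℝ} (h : 0 < s ∧ s < 1 / 2) :
    mtPt ψ x (s + 1) = mtPt ψ (ψ.symm x) s := by
  rw [mtPt_of_mem_two x ⟨by linarith, by linarith⟩, mtPt_of_mem_one _ ⟨h.1, by linarith⟩, eq_comm,
    mappingTorusGlued_inl_eq_inr_iff, mappingTorusRel]
  right
  exact ⟨rfl, (ψ.apply_symm_apply x).symm⟩

/-- The same relation read the other way: `[ψ x, s + 1] = [x, s]` for `s ∈ (0, 1/2)`. [folklore] -/
theorem mtPt_apply_add_one (x : ThreeTorus) {s : ℝ} (h : 0 < s ∧ s < 1 / 2) :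
    mtPt ψ (ψ x) (s + 1) = mtPt ψ x s := by
  rw [mtPt_add_one _ h, ψ.symm_apply_apply]

/-- **Injectivity in the second cylinder**: for `s, s' ∈ (1/2, 3/2)`. [folklore] -/
theorem mtPt_inj_two {x x' : ThreeTorus} {s s' : ℝ} (hs : 1 / 2 < s ∧ s < 3 / 2)
    (hs' : 1 / 2 < s' ∧ s' < 3 / 2) (h : mtPt ψ x s = mtPt ψ x' s') : x = x' ∧ s = s' := by
  rw [mtPt_of_mem_two x hs, mtPt_of_mem_two x' hs'] at h
  have h' := (mtGlueData ψ).inr_injective h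
  exact ⟨(Prod.ext_iff.1 h').1, congrArg Subtype.val (Prod.ext_iff.1 h').2⟩

/-- **Injectivity in the first cylinder**: for `s, s' ∈ (0, 1)`. [folklore] -/
theorem mtPt_inj_one {x x' : ThreeTorus} {s s' : ℝ} (hs : 0 < s ∧ s < 1) (hs' : 0 < s' ∧ s' < 1)
    (h : mtPt ψ x s = mtPt ψ x' s') : x = x' ∧ s = s' := by
  rw [mtPt_of_mem_one x hs, mtPt_of_mem_one x' hs'] at h
  have h' := (mtGlueData ψ).inl_injective h
  exact ⟨(Prod.ext_iff.1 h').1, congrArg Subtype.val (Prod.ext_iff.1 h').2⟩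

/-- **The general identification**: `[x, s] = [x', s']` with `s ∈ (0, 1)`, `s' ∈ (1/2, 3/2)` iff
either `s' = s, x' = x` or `s' = s + 1, x' = ψ x`. [folklore] -/
theorem mtPt_eq_mtPt_iff {x x' : ThreeTorus} {s s' : ℝ} (hs : 0 < s ∧ s < 1) (hs' : 1 / 2 < s' ∧ s' < 3 / 2) :
    mtPt ψ x s = mtPt ψ x' s' ↔ (s' = s ∧ x' = x) ∨ (s' = s + 1 ∧ x' = ψ x) := by
  rw [mtPt_of_mem_one x hs, mtPt_of_mem_two x' hs', mappingTorusGlued_inl_eq_inr_iff, mappingTorusRel]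

/-! ### Smoothness -/

section Smooth

variable {EQ HQ : Type*} [NormedAddCommGroup EQ] [NormedSpace ℝ EQ] [TopologicalSpace HQ]
  {IQ : ModelWithCorners ℝ EQ HQ} {Q : Type*} [TopologicalSpace Q] [ChartedSpace HQ Q]

/-- The clamp `max (min s b) a`. [folklore] -/
def clampR (a b s : ℝ) : ℝ := max (min s b) a

/-- The clamp lands in `[a, b]` (`a ≤ b`). [folklore] -/
theorem clampR_mem {a b : ℝ} (hab : a ≤ b) (s : ℝ) : clampR a b s ∈ Icc a b :=
  ⟨le_max_right _ _, max_le (min_le_right _ _) hab⟩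

/-- On `[a, b]` the clamp is the identity. [folklore] -/
theorem clampR_of_mem {a b s : ℝ} (h : s ∈ Icc a b) : clampR a b s = s := by
  rw [clampR, min_eq_left h.2, max_eq_left h.1]

/-- **Smoothness of `q ↦ [f q, g q]`** at a point where `f`, `g` are smooth and `g q ∈ (0, 3/2)`:
near `q` the map is `inr ∘ (f, g)` (if `g q > 1/2`) or `inl ∘ (f, g)` (if `g q < 1`), written
through a clamp of `g` to a compact subinterval so that the factor through the open piece is
globally defined. [folklore] -/
theorem contMDiffAt_mtPt_comp {f : Q → ThreeTorus} {g : Q → ℝ} {q : Q} (hf : ContMDiffAt IQ 𝓣 ∞ f q)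
    (hg : ContMDiffAt IQ 𝓘(ℝ, ℝ) ∞ g q) (h0 : 0 < g q) (h1 : g q < 3 / 2) :
    ContMDiffAt IQ 𝓘(ℝ, 𝔼 4) ∞ (fun q ↦ mtPt ψ (f q) (g q)) q := by
  have hgc : ContinuousAt g q := hg.continuousAt
  by_cases h2 : 1 / 2 < g q
  · -- second cylinder near `q`: clamp `g` to `[a, b] ⊂ (1/2, 3/2)` with `g q ∈ (a, b)`
    set a := (1 / 2 + g q) / 2 with ha
    set b := (g q + 3 / 2) / 2 with hb
    have hab : a < b := by rw [ha, hb]; linarith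
    have hmem : ∀ s, clampR a b s ∈ mappingTorusPieceTwo := fun s ↦ by
      have := clampR_mem hab.le s
      rw [mem_mappingTorusPieceTwo]
      constructor <;> [linarith [this.1]; linarith [this.2]]
    set F : Q → ThreeTorus × mappingTorusPieceTwo := fun q' ↦ (f q', ⟨clampR a b (g q'), hmem _⟩) with hF
    have hev : ∀ᶠ q' in 𝓝 q, g q' ∈ Ioo a b := hgc.eventually (isOpen_Ioo.mem_nhds ⟨by linarith, by linarith⟩)
    have hev' : (fun q ↦ mtPt ψ (f q) (g q)) =ᶠ[𝓝 q] fun q' ↦ (mtGlueData ψ).inr (F q') := by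
      filter_upwards [hev] with q' hq'
      have hc : clampR a b (g q') = g q' := clampR_of_mem ⟨hq'.1.le, hq'.2.le⟩
      rw [mtPt_of_mem_two _ ⟨by linarith [hq'.1], by linarith [hq'.2]⟩, hF]
      congr 2
      exact Subtype.ext hc.symm
    refine ContMDiffAt.congr_of_eventuallyEq ?_ hev'
    refine (mtGlueData ψ).contMDiff_inr.contMDiffAt.comp q (hf.prodMk ?_)
    rw [← ContMDiffAt.subtypeVal_comp_iff]
    have hev2 : (Subtype.val ∘ fun q' ↦ (⟨clampR a b (g q'), hmem _⟩ : mappingTorusPieceTwo)) =ᶠ[𝓝 q] g := by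
      filter_upwards [hev] with q' hq'
      exact clampR_of_mem ⟨hq'.1.le, hq'.2.le⟩
    exact hg.congr_of_eventuallyEq hev2
  · -- first cylinder near `q` (`g q ≤ 1/2 < 1`)
    rw [not_lt] at h2
    set a := g q / 2 with ha
    set b := (g q + 1) / 2 with hb
    have hab : a < b := by rw [ha, hb]; linarith
    have hmem : ∀ s, clampR a b s ∈ mappingTorusPieceOne := fun s ↦ by
      have := clampR_mem hab.le s
      rw [mem_mappingTorusPieceOne]
      constructor <;> [linarith [this.1]; linarith [this.2]]
    set F : Q → ThreeTorus × mappingTorusPieceOne := fun q' ↦ (f q', ⟨clampR a b (g q'), hmem _⟩) with hF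
    have hev : ∀ᶠ q' in 𝓝 q, g q' ∈ Ioo a b := hgc.eventually (isOpen_Ioo.mem_nhds ⟨by linarith, by linarith⟩)
    have hev' : (fun q ↦ mtPt ψ (f q) (g q)) =ᶠ[𝓝 q] fun q' ↦ (mtGlueData ψ).inl (F q') := by
      filter_upwards [hev] with q' hq'
      have hc : clampR a b (g q') = g q' := clampR_of_mem ⟨hq'.1.le, hq'.2.le⟩
      rw [mtPt_of_mem_one _ ⟨by linarith [hq'.1], by linarith [hq'.2]⟩, hF]
      congr 2
      exact Subtype.ext hc.symm
    refine ContMDiffAt.congr_of_eventuallyEq ?_ hev'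
    refine (mtGlueData ψ).contMDiff_inl.contMDiffAt.comp q (hf.prodMk ?_)
    rw [← ContMDiffAt.subtypeVal_comp_iff]
    have hev2 : (Subtype.val ∘ fun q' ↦ (⟨clampR a b (g q'), hmem _⟩ : mappingTorusPieceOne)) =ᶠ[𝓝 q] g := by
      filter_upwards [hev] with q' hq'
      exact clampR_of_mem ⟨hq'.1.le, hq'.2.le⟩
    exact hg.congr_of_eventuallyEq hev2

/-- Smoothness of `(x, s) ↦ [x, s]` on `T³ × (0, 3/2)`. [folklore] -/
theorem contMDiffAt_mtPt {p : ThreeTorus × ℝ} (h0 : 0 < p.2) (h1 : p.2 < 3 / 2) :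
    ContMDiffAt (ModelWithCorners.prod 𝓣 𝓘(ℝ, ℝ)) 𝓘(ℝ, 𝔼 4) ∞ (fun p : ThreeTorus × ℝ ↦ mtPt ψ p.1 p.2) p :=
  contMDiffAt_mtPt_comp contMDiffAt_fst contMDiffAt_snd h0 h1

end Smooth

/-! ### The section circle and the product tube in terms of `mtPt` -/

section Tube

variable (P : TubeTwistPair ψ)

/-- The section circle off `ptA`: `c(u) = [1, angA u]`. [folklore] -/
theorem secCircle_eq_mtPt {u : 𝕊 1} (hu : u ≠ ptA) : P.secCircle u = mtPt ψ 1 (angA u) := by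
  have h : 0 < angA u ∧ angA u < 1 := ⟨(angA_mem_Ioc u).1, angA_lt_one hu⟩
  rw [P.secCircle_of_ne hu, mtPt_of_mem_one 1 h]
  congr 2
  exact Subtype.ext (coe_angAPt hu)

/-- The section circle off `ptB`: `c(u) = [1, angB u]`. [folklore] -/
theorem secCircle_eq_mtPt_B {u : 𝕊 1} (hu : u ≠ ptB) : P.secCircle u = mtPt ψ 1 (angB u) := by
  rw [P.secCircle_of_ne_ptB hu, mtPt_of_mem_two 1 (angB_mem_Ioo hu)]
  congr 2
  exact Subtype.ext (coe_angBPt hu)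

/-- **A point `[x, s]` (`0 < s < 3/2`) lies on the section circle iff `x = 1`**, provided the
monodromy fixes `1`. [folklore] -/
theorem mtPt_mem_range_secCircle_iff (h1 : ψ 1 = 1) {x : ThreeTorus} {s : ℝ} (hs0 : 0 < s)
    (hs1 : s < 3 / 2) : mtPt ψ x s ∈ range P.secCircle ↔ x = 1 := by
  constructor
  · rintro ⟨u, hu⟩
    rcases ne_ptA_or_ne_ptB u with hA | hB
    · rw [secCircle_eq_mtPt P hA] at hu
      have ha : 0 < angA u ∧ angA u < 1 := ⟨(angA_mem_Ioc u).1, angA_lt_one hA⟩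
      by_cases hs : s < 1
      · exact ((mtPt_inj_one ha ⟨hs0, hs⟩ hu).1).symm
      · rw [not_lt] at hs
        rcases (mtPt_eq_mtPt_iff ha ⟨by linarith, hs1⟩).1 hu with ⟨-, hx⟩ | ⟨-, hx⟩
        · exact hx
        · rw [hx, h1]
    · rw [secCircle_eq_mtPt_B P hB] at hu
      have hb := angB_mem_Ioo hB
      by_cases hs : 1 / 2 < s
      · exact ((mtPt_inj_two ⟨hb.1, hb.2⟩ ⟨hs, hs1⟩ hu).1).symm
      · rw [not_lt] at hs
        rcases (mtPt_eq_mtPt_iff ⟨hs0, by linarith⟩ ⟨hb.1, hb.2⟩).1 hu.symm with ⟨-, hx⟩ | ⟨hs', hx⟩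
        · exact hx.symm
        · -- `angB u = s + 1` with `s ≤ 1/2`, and `x = ψ⁻¹ 1 = 1`
          apply ψ.injective
          show ψ x = ψ 1
          rw [← hx, h1]
  · rintro rfl
    by_cases hs : s < 1
    · refine ⟨circlePt s, ?_⟩
      have hne : circlePt s ≠ ptA := circlePt_ne_ptA ⟨s, ⟨hs0, hs⟩⟩
      rw [secCircle_eq_mtPt P hne, angA_circlePt ⟨hs0, hs⟩]
    · rw [not_lt] at hs
      refine ⟨circlePt s, ?_⟩
      have hmem : s ∈ Ioo (1 / 2 : ℝ) (3 / 2) := ⟨by linarith, hs1⟩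
      have hne : circlePt s ≠ ptB := by
        intro h
        have := congrArg angB h
        rw [angB_circlePt hmem, angB_ptB] at this
        linarith
      rw [secCircle_eq_mtPt_B P hne, angB_circlePt hmem]

end Tube

end Literature.Topology.FourManifolds
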